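import Summits.ABC.IUTFork.Conditional.WRowFrey283Packages
import HarnessLib

/-!
# R-W WINDOW-TABLE, W1 ROW DECISION (inhabited side): the known abc triple `283 + 5¹¹·13² = 2⁸·3⁸·17³` at `l = 19`
# — the hull licence S_H HOLDS at every genuine Θ-volume datum over `(ratPoint (283/2⁸3⁸17³), 19)` of the TABULATED LOCAL TYPE

PROOF-ONLY file (D-0012; 0 definitions, 0 `Prop` facts) of the abc-iut cell — D-0079 RESCUE sub-cell R-W «WINDOW Θ-SIDE INEQUALITY», W1 ROW
DECISIONS composer seat abc-iut-W-row-1 (gen 0); row 3 of HOME/plan/rescue/R-W/OPEN-10.md (sha16 1b0025ee7a8ba6d7, abc-iut-rw-num-lead):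
`pilotDataOfK:frey-283-8251953125-8251953408:19`. Over `WRowFrey283Packages` (local packages, pole orders, bad primes) and the sockets
`Cor312LicenceWildInhabitedRealising` / `…GenuineK` (abc-iut-w4-d036's U2-LICENCE-WRAPPER p460046/p460573 composed over all tuples).
TAKES NO SIDE on [IUTchIII] Cor. 3.12 (S. Mochizuki, *Inter-universal Teichmüller theory III*, Cor. 3.12 p. 173–174; Step (xi-f) p. 184) or on
any author; «inhabited as typed» ≠ «asserted in print».

WHAT IS PROVED (namespace `Summit.ABC.IUTFork.Conditional`): **`WRow.licence_frey283_nineteen`** — for EVERY genuine Θ-volume datum `T` at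
`(ratPoint (283/8251953408), 19)` and EVERY pair of realising Θ- and q-ideles: IF the bad completions have the LOCAL TYPE of the table (wild at
`3, 5`: ramification index and a lower bound on the different; tame poles: ramification index; a common candidate at `283`) and are pairwise
`ℚ_p`-isomorphic over each bad prime, THEN abc-iut-c312-1's `Thm311ToCor312.Licence` HOLDS at `settingPrVolSharp (pilotDataOfK T.D T.K) …`
(branch C's «∃ ρ qK, QPinned ∧ PilotKummerCompatHull» follows by abc-iut-w5-d009's `exists_qPinned_and_hull_settingPrVolSharp_iff_licence`).
READING (neutral; numbers, not adjectives): the per-datum S_H clause of the window certificates' binder `hSHwBad` (p453137 / p450130) is INHABITED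
at this Szpiro-BAD admissible-candidate row CONDITIONALLY on the local type at the bad primes (GAP-LEDGER G-Wnum2-1 at `3, 5`; the pinned tame
types of abc-iut-W-num-3) and the conjugacy of the bad fibre — no number-level hypothesis is consumed. Admissibility / (P6) of `(ratPoint λ, 19)`
and NON-EMPTINESS of the datum type are NOT claimed. HONEST SCOPE: OUR sharp containers; STRONGER-THAN-PRINT hull reading; nothing about the
printed inequality or any author's intended hull; typed ≠ proved; instantiated ≠ endorsed; no abc claim.
[cite: Mochizuki2012, IUTchI Def. 3.1 (b),(c) pp. 61–62, Ex. 3.2 (iv) p. 71; IUTchIII Cor. 3.12 Step (xi-f) p. 184; IUTchIV Prop. 1.1 p. 9,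
Prop. 1.2 (i)(ii) p. 10, Prop. 1.4 (ii) p. 13, Cor. 2.2 (ii) proof (P5) p. 46] [cite: DupuyHilado2025, §3.3, §3.4, §4.9, §4.12]
[cite: NeukirchANT1999, Ch. II (5.5)] [claim: Mochizuki2012, status: disputed] for every IUT sentence.
-/

noncomputable section

open Set Function Metric NumberField IsDedekindDomain

namespace Summit.ABC.IUTFork.Conditional

open Thm311 Thm311.Real Cor312 Cor312Vol Cor312Prov Literature.IUT.LogThetaLattice Literature.IUT.LogVolume
  Literature.IUT.HodgeTheaters Literature.IUT.LogVolume.Cor22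
open Literature.NumberTheory.NumberFields Literature.NumberTheory.GaloisRepresentations.Ultrametric
open Literature.NumberTheory.DiophantineGeometry Literature.NumberTheory.DiophantineGeometry.GenEll

/-! ## The row `pilotDataOfK:frey-283-8251953125-8251953408:19`: S_H INHABITED at the tabulated local type -/

/-- **W1 ROW DECISION, INHABITED SIDE — `283 + 5¹¹·13² = 2⁸·3⁸·17³` at `l = 19`.** For EVERY genuine Θ-volume datum `T` at
`(ratPoint (283/8251953408), 19)` ([IUTchIV] Cor. 2.2 (ii) proof (P7)) and EVERY pair of Θ- and q-ideles realising the pilot divisors of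
`X := pilotDataOfK T.D T.K`: IF the completions at the bad places have the TABULATED LOCAL TYPE — over `3`: `e = 570` and different exponent `≥ 1139`; over `5`: `e = 1140` and different exponent `≥ 2279` (GAP-LEDGER G-Wnum2-1, wild);
over `13`: `e = 285`; over `17`: `e = 190`; over `283`: a common `e ∈ {285, 570}` — and are pairwise `ℚ_p`-isomorphic over each bad prime (conjugate fibre), THEN
abc-iut-c312-1's `Thm311ToCor312.Licence` HOLDS at abc-iut-c312-7's `settingPrVolSharp X …` (the per-datum S_H of the window certificates,
INHABITED). Shell radii DERIVED (inner read trivially `ρin = 1` by volume at `3, 5`, abc-iut-c312-3's closed form elsewhere; outer = envelope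
`p^{a₀} − e·a₀`); integer cells at every label `j ≤ 9` by `decide` (margins ≥ 6762 (p=3), 8090 (5), 1402 (13), 566 (17), 304/1174 (283)). [cite: Mochizuki2012, IUTchIII Cor. 3.12 Step (xi-f) p. 184;
IUTchIV Prop. 1.1 p. 9, Prop. 1.2 (i)(ii) p. 10, Cor. 2.2 (ii) p. 46] [cite: DupuyHilado2025, §3.3, §3.4, §4.9, §4.12] [claim: Mochizuki2012, status: disputed] -/
theorem WRow.licence_frey283_nineteen (T : Cor22.ThetaVolumeDatumAt (ratPoint ((283 : ℚ) / 8251953408)) 19) (e283 : ℕ)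
    (he283 : e283 = 285 ∨ e283 = 570) :
    letI := T.instFieldF; letI := T.instNumberFieldF; letI := T.instAlgebraF; letI := T.instFieldK
    letI := T.instNumberFieldK; letI := T.instAlgebraK; letI := T.instFieldFbar; letI := T.instAlgebraFbar
    letI := T.instAlgebraKFbar; letI := T.instIsElliptic
    -- LOCAL TYPE at the bad primes (hypotheses) and conjugacy of the bad fibre
    (∀ (pp : Nat.Primes), (pp : ℕ) = 3 → ∀ x : (thetaIndex (pilotDataOfK T.D T.K)).Fibre (.inr pp),
        haveI : Fact (pp : ℕ).Prime := ⟨pp.2⟩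
        placeOf (pilotDataOfK T.D T.K) pp.1 x ∈ (pilotDataOfK T.D T.K).S →
          absRamificationIdx (pp : ℕ) (kOf (pilotDataOfK T.D T.K) pp.1 x) = 570 ∧
            ((1139 : ℕ) : ℝ) / ((570 : ℕ) : ℝ) ≤ differentOrd (pp : ℕ) (kOf (pilotDataOfK T.D T.K) pp.1 x)) →
    (∀ (pp : Nat.Primes), (pp : ℕ) = 5 → ∀ x : (thetaIndex (pilotDataOfK T.D T.K)).Fibre (.inr pp),
        haveI : Fact (pp : ℕ).Prime := ⟨pp.2⟩
        placeOf (pilotDataOfK T.D T.K) pp.1 x ∈ (pilotDataOfK T.D T.K).S →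
          absRamificationIdx (pp : ℕ) (kOf (pilotDataOfK T.D T.K) pp.1 x) = 1140 ∧
            ((2279 : ℕ) : ℝ) / ((1140 : ℕ) : ℝ) ≤ differentOrd (pp : ℕ) (kOf (pilotDataOfK T.D T.K) pp.1 x)) →
    (∀ (pp : Nat.Primes), (pp : ℕ) = 13 → ∀ x : (thetaIndex (pilotDataOfK T.D T.K)).Fibre (.inr pp),
        haveI : Fact (pp : ℕ).Prime := ⟨pp.2⟩
        placeOf (pilotDataOfK T.D T.K) pp.1 x ∈ (pilotDataOfK T.D T.K).S →
          absRamificationIdx (pp : ℕ) (kOf (pilotDataOfK T.D T.K) pp.1 x) = 285) →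
    (∀ (pp : Nat.Primes), (pp : ℕ) = 17 → ∀ x : (thetaIndex (pilotDataOfK T.D T.K)).Fibre (.inr pp),
        haveI : Fact (pp : ℕ).Prime := ⟨pp.2⟩
        placeOf (pilotDataOfK T.D T.K) pp.1 x ∈ (pilotDataOfK T.D T.K).S →
          absRamificationIdx (pp : ℕ) (kOf (pilotDataOfK T.D T.K) pp.1 x) = 190) →
    (∀ (pp : Nat.Primes), (pp : ℕ) = 283 → ∀ x : (thetaIndex (pilotDataOfK T.D T.K)).Fibre (.inr pp),
        haveI : Fact (pp : ℕ).Prime := ⟨pp.2⟩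
        placeOf (pilotDataOfK T.D T.K) pp.1 x ∈ (pilotDataOfK T.D T.K).S →
          absRamificationIdx (pp : ℕ) (kOf (pilotDataOfK T.D T.K) pp.1 x) = e283) →
    (∀ (pp : Nat.Primes) (x y : (thetaIndex (pilotDataOfK T.D T.K)).Fibre (.inr pp)),
      haveI : Fact (pp : ℕ).Prime := ⟨pp.2⟩
      placeOf (pilotDataOfK T.D T.K) pp.1 x ∈ (pilotDataOfK T.D T.K).S → placeOf (pilotDataOfK T.D T.K) pp.1 y ∈ (pilotDataOfK T.D T.K).S →
        Nonempty (kOf (pilotDataOfK T.D T.K) pp.1 x ≃ₐ[ℚ_[pp]] kOf (pilotDataOfK T.D T.K) pp.1 y)) →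
    ∀ {logv : PadicLogs T.K} (hlog : LogvAnalytic logv) (M : Type) [Field M] [NumberField M]
      (archPk : ∀ (j : (thetaIndex (pilotDataOfK T.D T.K)).Label) (vQ : (thetaIndex (pilotDataOfK T.D T.K)).VQ),
        Set ((logShellsDH (pilotDataOfK T.D T.K) logv).Packet j vQ))
      (archSub : ∀ (j : (thetaIndex (pilotDataOfK T.D T.K)).Label) (v : (thetaIndex (pilotDataOfK T.D T.K)).V),
        Set ((logShellsDH (pilotDataOfK T.D T.K) logv).Packet j ((thetaIndex (pilotDataOfK T.D T.K)).over v)))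
      (Ψ : ℤ → ∀ v : (thetaIndex (pilotDataOfK T.D T.K)).V, v ∈ (thetaIndex (pilotDataOfK T.D T.K)).Vbad →
        Set ((logShellsDH (pilotDataOfK T.D T.K) logv).StarPacket v))
      (act : ℤ → ∀ v : (thetaIndex (pilotDataOfK T.D T.K)).V, v ∈ (thetaIndex (pilotDataOfK T.D T.K)).Vbad →
        (logShellsDH (pilotDataOfK T.D T.K) logv).StarPacket v → Module.End ℚ ((logShellsDH (pilotDataOfK T.D T.K) logv).StarPacket v))
      (Mmod : ℤ → ∀ j : (thetaIndex (pilotDataOfK T.D T.K)).LabelStar, Set ((logShellsDH (pilotDataOfK T.D T.K) logv).GlobalPacket j.1))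
      (region : ℤ → ∀ j : (thetaIndex (pilotDataOfK T.D T.K)).LabelStar, FinDivisor M → ∀ vQ : (thetaIndex (pilotDataOfK T.D T.K)).VQ,
        Set ((logShellsDH (pilotDataOfK T.D T.K) logv).Packet j.1 vQ))
      (n : ℤ) {HT : Type} {LogLink : HT → HT → Type} {IsFull : ∀ {s t : HT}, LogLink s t → Prop}
      (lat : LGPGaussianLogThetaLattice LogLink IsFull)
      {Frd : Type} {IsoF : Frd → Frd → Type} {Ob : Frd → Type} {realify : Frd → Frd} {Strip : Type}
      {IsoS : Strip → Strip → Type} {Mv : ∀ v : (thetaIndex (pilotDataOfK T.D T.K)).V, v ∈ (thetaIndex (pilotDataOfK T.D T.K)).Vbad → Type}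
      [∀ v h, Monoid (Mv v h)]
      (sig : GlobalLGPFrobenioidSignature (thetaIndex (pilotDataOfK T.D T.K)).lstar (thetaIndex (pilotDataOfK T.D T.K)).V
        (· ∈ (thetaIndex (pilotDataOfK T.D T.K)).Vbad) Frd IsoF Ob realify Strip IsoS Mv)
      (split : SplittingMonoids Mv) {ObΔ : Type} {N : ∀ v : (thetaIndex (pilotDataOfK T.D T.K)).V, v ∈ (thetaIndex (pilotDataOfK T.D T.K)).Vbad → Type}
      [∀ v h, Monoid (N v h)] (qData : QPilotData ObΔ N)
      (tq : ∀ (pp : Nat.Primes) (x : (thetaIndex (pilotDataOfK T.D T.K)).Fibre (.inr pp)),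
        haveI : Fact (pp : ℕ).Prime := ⟨pp.2⟩; kOf (pilotDataOfK T.D T.K) pp.1 x)
      (t : ∀ (pp : Nat.Primes) (_ : Fin (pilotDataOfK T.D T.K).lstar) (x : (thetaIndex (pilotDataOfK T.D T.K)).Fibre (.inr pp)),
        haveI : Fact (pp : ℕ).Prime := ⟨pp.2⟩; kOf (pilotDataOfK T.D T.K) pp.1 x)
      (htq0 : ∀ pp x, tq pp x ≠ 0)
      (htq1 : ∀ (pp : Nat.Primes) (x : (thetaIndex (pilotDataOfK T.D T.K)).Fibre (.inr pp)),
        haveI : Fact (pp : ℕ).Prime := ⟨pp.2⟩; placeOf (pilotDataOfK T.D T.K) pp.1 x ∉ (pilotDataOfK T.D T.K).S → ‖tq pp x‖ = 1)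
      (_ht0 : ∀ pp i x, t pp i x ≠ 0)
      (_ht : ∀ (pp : Nat.Primes) (i : Fin (pilotDataOfK T.D T.K).lstar) (x : (thetaIndex (pilotDataOfK T.D T.K)).Fibre (.inr pp)),
        haveI : Fact (pp : ℕ).Prime := ⟨pp.2⟩
        Real.log ‖t pp i x‖ = -((pilotDataOfK T.D T.K).thetaPilot i (placeOf (pilotDataOfK T.D T.K) pp.1 x)) *
          logNorm T.K (placeOf (pilotDataOfK T.D T.K) pp.1 x) / localDegree T.K (placeOf (pilotDataOfK T.D T.K) pp.1 x))
      (_htq : ∀ (pp : Nat.Primes) (x : (thetaIndex (pilotDataOfK T.D T.K)).Fibre (.inr pp)),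
        haveI : Fact (pp : ℕ).Prime := ⟨pp.2⟩
        Real.log ‖tq pp x‖ = -((pilotDataOfK T.D T.K).qPilot (placeOf (pilotDataOfK T.D T.K) pp.1 x)) *
          logNorm T.K (placeOf (pilotDataOfK T.D T.K) pp.1 x) / localDegree T.K (placeOf (pilotDataOfK T.D T.K) pp.1 x)),
      Thm311ToCor312.Licence
        (settingPrVolSharp (pilotDataOfK T.D T.K) hlog M archPk archSub Ψ act Mmod region n lat sig split qData tq t htq0 htq1) := by
  letI := T.instFieldF; letI := T.instNumberFieldF; letI := T.instAlgebraF; letI := T.instFieldK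
  letI := T.instNumberFieldK; letI := T.instAlgebraK; letI := T.instFieldFbar; letI := T.instAlgebraFbar
  letI := T.instAlgebraKFbar; letI := T.instIsElliptic
  intro hloc3 hloc5 hloc13 hloc17 hloc283 hiso logv hlog M _ _ archPk archSub Ψ act Mmod region n HT LogLink IsFull lat Frd IsoF Ob realify Strip
    IsoS Mv _ sig split ObΔ N _ qData tq t htq0 htq1 ht0 ht htq
  have hjF : T.E.j = ((jInv ((283 : ℚ) / 8251953408) : ℚ) : T.F) := by rw [T.j_eq]; exact eq_ratCast _ _
  have hlstar : (pilotDataOfK T.D T.K).lstar = 9 := by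
    show ((pilotDataOfK T.D T.K).l - 1) / 2 = 9
    rw [pilotDataOfK_l]
  -- the per-prime data (e, D, h, ρin, ρout)
  set eF : Nat.Primes → ℕ := fun pp => if (pp : ℕ) = 3 then 570 else if (pp : ℕ) = 5 then 1140 else if (pp : ℕ) = 13 then 285 else if (pp : ℕ) = 17 then 190 else e283 with heF
  set DF : Nat.Primes → ℕ := fun pp => if (pp : ℕ) = 3 then 1139 else if (pp : ℕ) = 5 then 2279 else if (pp : ℕ) = 13 then 284 else if (pp : ℕ) = 17 then 189 else e283 - 1 with hDF
  set hF : Nat.Primes → ℕ := fun pp => if (pp : ℕ) = 2 then 16 else if (pp : ℕ) = 3 then 16 else if (pp : ℕ) = 5 then 22 else if (pp : ℕ) = 13 then 4 else if (pp : ℕ) = 17 then 6 else 2 with hhF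
  set rinF : Nat.Primes → ℤ := fun pp => if (pp : ℕ) = 3 then 1 else if (pp : ℕ) = 5 then 1 else if (pp : ℕ) = 13 then 24 else if (pp : ℕ) = 17 then 12 else if e283 = 285 then 2 else 3 with hrinF
  set routF : Nat.Primes → ℤ := fun pp => if (pp : ℕ) = 3 then (-2691) else if (pp : ℕ) = 5 then (-3935) else if (pp : ℕ) = 13 then (-401) else if (pp : ℕ) = 17 then (-173) else if e283 = 285 then (-2) else (-287) with hroutF
  refine Cor312Prov.licence_settingPrVolSharp_pilotDataOfK_of_orders_rat T.D hlog M archPk archSub Ψ act Mmod region n lat sig split qData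
    tq t htq0 htq1 ht0 ht htq (jInv ((283 : ℚ) / 8251953408)) hjF eF DF hF rinF routF (fun pp x hx => ?_) hiso (fun pp hpp i => ?_)
  · -- the local packages at a bad place `x | p`
    haveI : Fact (pp : ℕ).Prime := ⟨pp.2⟩
    rcases (WRow.bad_prime_frey283 T pp x hx).2 with ⟨hp, hord⟩ | ⟨hp, hord⟩ | ⟨hp, hord⟩ | ⟨hp, hord⟩ | ⟨hp, hord⟩
    · have h1 : eF pp = 570 := by simp [heF, hp]
      have h2 : DF pp = 1139 := by simp [hDF, hp]
      have h3 : hF pp = 16 := by simp [hhF, hp]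
      have h4 : rinF pp = 1 := by simp [hrinF, hp]
      have h5 : routF pp = (-2691) := by simp [hroutF, hp]
      rw [h1, h2, h3, h4, h5]
      obtain ⟨he, hD⟩ := hloc3 pp hp x hx
      exact ⟨he, hD, WRow.inner_witness_trivial (pp : ℕ) _ 570,
        WRow.outer_witness_envelope (pp : ℕ) _ he 6 (by rw [hp]; decide) (by rw [hp]; decide) (-2691) (by rw [hp]; norm_num),
        by simpa using hord, by decide⟩
    · have h1 : eF pp = 1140 := by simp [heF, hp]
      have h2 : DF pp = 2279 := by simp [hDF, hp]
      have h3 : hF pp = 22 := by simp [hhF, hp]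
      have h4 : rinF pp = 1 := by simp [hrinF, hp]
      have h5 : routF pp = (-3935) := by simp [hroutF, hp]
      rw [h1, h2, h3, h4, h5]
      obtain ⟨he, hD⟩ := hloc5 pp hp x hx
      exact ⟨he, hD, WRow.inner_witness_trivial (pp : ℕ) _ 1140,
        WRow.outer_witness_envelope (pp : ℕ) _ he 4 (by rw [hp]; decide) (by rw [hp]; decide) (-3935) (by rw [hp]; norm_num),
        by simpa using hord, by decide⟩
    · have h1 : eF pp = 285 := by simp [heF, hp]
      have h2 : DF pp = 284 := by simp [hDF, hp]
      have h3 : hF pp = 4 := by simp [hhF, hp]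
      have h4 : rinF pp = 24 := by simp [hrinF, hp]
      have h5 : routF pp = (-401) := by simp [hroutF, hp]
      rw [h1, h2, h3, h4, h5]
      have he := hloc13 pp hp x hx
      exact ⟨he, WRow.different_lower_of_not_dvd (pp : ℕ) _ he (by rw [hp]; norm_num) 284 (by norm_num),
        WRow.inner_witness_of_not_dvd (pp : ℕ) _ he (by rw [hp]; norm_num) 24 (by rw [hp]; norm_num),
        WRow.outer_witness_envelope (pp : ℕ) _ he 2 (by rw [hp]; decide) (by rw [hp]; decide) (-401) (by rw [hp]; norm_num),
        by simpa using hord, by decide⟩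
    · have h1 : eF pp = 190 := by simp [heF, hp]
      have h2 : DF pp = 189 := by simp [hDF, hp]
      have h3 : hF pp = 6 := by simp [hhF, hp]
      have h4 : rinF pp = 12 := by simp [hrinF, hp]
      have h5 : routF pp = (-173) := by simp [hroutF, hp]
      rw [h1, h2, h3, h4, h5]
      have he := hloc17 pp hp x hx
      exact ⟨he, WRow.different_lower_of_not_dvd (pp : ℕ) _ he (by rw [hp]; norm_num) 189 (by norm_num),
        WRow.inner_witness_of_not_dvd (pp : ℕ) _ he (by rw [hp]; norm_num) 12 (by rw [hp]; norm_num),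
        WRow.outer_witness_envelope (pp : ℕ) _ he 1 (by rw [hp]; decide) (by rw [hp]; decide) (-173) (by rw [hp]; norm_num),
        by simpa using hord, by decide⟩
    · have he := hloc283 pp hp x hx
      rcases he283 with rfl | rfl
      · have h1 : eF pp = 285 := by simp [heF, hp]
        have h2 : DF pp = 284 := by simp [hDF, hp]
        have h3 : hF pp = 2 := by simp [hhF, hp]
        have h4 : rinF pp = 2 := by simp [hrinF, hp]
        have h5 : routF pp = (-2) := by simp [hroutF, hp]
        rw [h1, h2, h3, h4, h5]
        exact ⟨he, WRow.different_lower_of_not_dvd (pp : ℕ) _ he (by rw [hp]; norm_num) 284 (by norm_num),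
          WRow.inner_witness_of_not_dvd (pp : ℕ) _ he (by rw [hp]; norm_num) 2 (by rw [hp]; norm_num),
          WRow.outer_witness_envelope (pp : ℕ) _ he 1 (by rw [hp]; decide) (by rw [hp]; decide) (-2) (by rw [hp]; norm_num),
          by simpa using hord, by decide⟩
      · have h1 : eF pp = 570 := by simp [heF, hp]
        have h2 : DF pp = 569 := by simp [hDF, hp]
        have h3 : hF pp = 2 := by simp [hhF, hp]
        have h4 : rinF pp = 3 := by simp [hrinF, hp]
        have h5 : routF pp = (-287) := by simp [hroutF, hp]
        rw [h1, h2, h3, h4, h5]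
        exact ⟨he, WRow.different_lower_of_not_dvd (pp : ℕ) _ he (by rw [hp]; norm_num) 569 (by norm_num),
          WRow.inner_witness_of_not_dvd (pp : ℕ) _ he (by rw [hp]; norm_num) 3 (by rw [hp]; norm_num),
          WRow.outer_witness_envelope (pp : ℕ) _ he 1 (by rw [hp]; decide) (by rw [hp]; decide) (-287) (by rw [hp]; norm_num),
          by simpa using hord, by decide⟩
  · -- the integer cells at every label `j = i + 1 ≤ 9`
    haveI : Fact (pp : ℕ).Prime := ⟨pp.2⟩
    obtain ⟨x, hx⟩ := hpp
    have hi : (i : ℕ) < 9 := hlstar ▸ i.isLt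
    generalize hk : (i : ℕ) = k at hi ⊢
    rcases (WRow.bad_prime_frey283 T pp x hx).2 with ⟨hp, -⟩ | ⟨hp, -⟩ | ⟨hp, -⟩ | ⟨hp, -⟩ | ⟨hp, -⟩
    · have h1 : eF pp = 570 := by simp [heF, hp]
      have h2 : DF pp = 1139 := by simp [hDF, hp]
      have h3 : hF pp = 16 := by simp [hhF, hp]
      have h4 : rinF pp = 1 := by simp [hrinF, hp]
      have h5 : routF pp = (-2691) := by simp [hroutF, hp]
      rw [h1, h2, h3, h4, h5]
      interval_cases k <;> decide
    · have h1 : eF pp = 1140 := by simp [heF, hp]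
      have h2 : DF pp = 2279 := by simp [hDF, hp]
      have h3 : hF pp = 22 := by simp [hhF, hp]
      have h4 : rinF pp = 1 := by simp [hrinF, hp]
      have h5 : routF pp = (-3935) := by simp [hroutF, hp]
      rw [h1, h2, h3, h4, h5]
      interval_cases k <;> decide
    · have h1 : eF pp = 285 := by simp [heF, hp]
      have h2 : DF pp = 284 := by simp [hDF, hp]
      have h3 : hF pp = 4 := by simp [hhF, hp]
      have h4 : rinF pp = 24 := by simp [hrinF, hp]
      have h5 : routF pp = (-401) := by simp [hroutF, hp]
      rw [h1, h2, h3, h4, h5]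
      interval_cases k <;> decide
    · have h1 : eF pp = 190 := by simp [heF, hp]
      have h2 : DF pp = 189 := by simp [hDF, hp]
      have h3 : hF pp = 6 := by simp [hhF, hp]
      have h4 : rinF pp = 12 := by simp [hrinF, hp]
      have h5 : routF pp = (-173) := by simp [hroutF, hp]
      rw [h1, h2, h3, h4, h5]
      interval_cases k <;> decide
    · rcases he283 with rfl | rfl
      · have h1 : eF pp = 285 := by simp [heF, hp]
        have h2 : DF pp = 284 := by simp [hDF, hp]
        have h3 : hF pp = 2 := by simp [hhF, hp]
        have h4 : rinF pp = 2 := by simp [hrinF, hp]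
        have h5 : routF pp = (-2) := by simp [hroutF, hp]
        rw [h1, h2, h3, h4, h5]
        interval_cases k <;> decide
      · have h1 : eF pp = 570 := by simp [heF, hp]
        have h2 : DF pp = 569 := by simp [hDF, hp]
        have h3 : hF pp = 2 := by simp [hhF, hp]
        have h4 : rinF pp = 3 := by simp [hrinF, hp]
        have h5 : routF pp = (-287) := by simp [hroutF, hp]
        rw [h1, h2, h3, h4, h5]
        interval_cases k <;> decide

end Summit.ABC.IUTFork.Conditional

end
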